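import Mathlib.NumberTheory.Cyclotomic.Basic
import Literature.NumberTheory.EllipticCurves.Wuthrich2014.ReducibleDivisibilityCyclotomicThree
import Literature.NumberTheory.EllipticCurves.Wuthrich2014.SurjectiveMultiplicativeDivisibility
import Literature.NumberTheory.EllipticCurves.PAdicLFunctionMinusMult
import HarnessLib

/-!
# Kato's divisibility at a SPLIT MULTIPLICATIVE `p = 3` for curves with SURJECTIVE `ρ_{E,3^∞}`, read over
# `K = ℚ(ζ₃)` (Wuthrich 2014, Thm. 3 / Cor. 19 with the factor `I`, "proven by Kato"; named fact):
# `T · char_Λ X(E/ℚ(ζ_{3^∞})) ∋ u · L₃(E, ω⁰, T) · L₃(E, ω¹, T)`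

Source, as PUBLISHED: C. Wuthrich, Doc. Math. 19 (2014) 381–402 [Wuthrich2014]. §1 (p. 383): "We
formulate it here for the full cyclotomic `ℤ_p^×`-extension. Theorem 3. Let `E` be an elliptic curve
and `p` an odd prime of semi-stable reduction. Assume that `E[p]` is reducible […]. Then the
characteristic series of the dual of the Selmer group over the cyclotomic extension [divides the ideal
generated by `L_p(E)`]. In the case when `E` has split multiplicative reduction, one can strengthen
this a bit, see theorem 16. This theorem was proven by Kato in [Kato 2004] in the case that [the
reduction is ordinary and] the representation on the Tate module was surjective."; §6 Cor. 19 (p. 398)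
and its proof (p. 399): "If `E/ℚ` is a semi-stable elliptic curve and `p` an odd prime [where `E` has
ordinary reduction], then `char_Λ X(E)`, **or `I char_Λ X(E)` in the split multiplicative case**,
divides the ideal generated by `L_p(E)`. Proof. […] in the first case the representation
`ρ_p : G_ℚ → Aut(T_p E)` is surjective by another result of Serre unless `p = 3`. Finally for `p = 3` we
use [Lemma 20]" — the FIRST CASE of the printed proof derives the conclusion, with the factor `I` at a
split prime, from the surjectivity of `ρ_p` on `T_p E` alone (Kato Thm. 12.5 (4) under (12.5.2) +
§3.2: "in the case when `E` has split multiplicative reduction, then Theorem 4.1 in [Kobayashi 2006]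
proves that the Coleman map … is injective and has image with finite index inside `I`"); §5 (p. 397):
`X(E)` = dual of `lim_n Sel(E/ℚ(ζ_{p^n}))`, torsion ("see [Kobayashi] for the split multiplicative
case"; also Greenberg LNM 1716 Thm. 1.5 for the abelian base `ℚ(ζ₃)`); §3 (p. 390): `Λ = ℤ_p⟦G⟧`,
`M = ⊕ M_i`; Cor. 18: `L_p(E) ∈ Λ`.

ONE NAMED FACT (`def … : Prop`, nothing asserted, D-0014/D-0026): "Kato's theorem as attributed in
Wuthrich Thm. 3 / Cor. 19 (first case of the proof)", SPLIT multiplicative clause (with `I`) at `p = 3`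
over the `ℤ₃^×`-extension, read over `K = ℚ(ζ₃)` — the split twin of
`kato_charIdeal_dvd_nonsplitMultiplicative_cyclotomicThree_of_surjective` (p217668) and, over `ℚ_∞`, of
clause (3) of `kato_charIdeal_dvd_multiplicative_of_surjective` (p181258, flag `Wu14-surj-attribution`:
`ι(T · g) = ϖ · L`). `K`-reading as in `ReducibleSplitMultiplicativeDivisibilityCyclotomicThree`:
`ℚ(ζ_{3^∞}) = K_∞`, `Λ(G) = Λ(Γ)e₊ ⊕ Λ(Γ)e₋`, `e₊I = (T)`, `e₋I = e₋Λ`, so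
`T · char_{Λ(Γ)} X(E/K_∞) ∋ L₃(E,ω⁰,T)·L₃(E,ω¹,T)`; even branch = THE `L` with
`IsSplitMultPAdicLFunctionOf f 3 L`, odd branch = `padicLFunctionMinusBranchMult f 1 1`; image
hypothesis `∀ n, HasSurjectiveModNGaloisRep (3^n)`.

Hypotheses transcribed: `E = V` globally minimal over `ℚ`, SPLIT multiplicative at `3`, `ρ̄_{E,3^n}` onto
for every `n`, `K` cyclotomic `{3}` over `ℚ`, `V'` any `K`-model of `E_K`, `κ` cyclotomic with
topological generator `γ`, `χ₃(γ)·ζ = 4`, `f` the newform of `E`, `D` a dual datum of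
`Sel_{3^∞}(E/K_∞)`, the periods, and `L` the even branch. Conclusion: `X(E/K_∞)` is `Λ`-torsion and
`ι(T · g) = u ϖϖ' · L · L⁻₃(f,1,ω¹,T)` for some `g ∈ char`, `u ∈ ℤ₃ˣ`. Proposed flags:
`Wu14-surj-attribution` and `Wu14-Thm16-p3-branch-split`. What is NOT here: `p ≠ 3`, global
semistability (Cor. 19's own hypothesis — replaced, as in p181258, by the surjectivity it is used to
produce), any proof.
-- TODO(general form): the statement for every odd `p` over `ℚ(μ_p)`.

Consumer: additive-p4 line V16 — the (M)-rows of class X4 at `p = 3` whose twist `V = W^{(−3)}` is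
SPLIT multiplicative at `3` (`ρ_{V,3^∞}` onto from the census bits surj(3) ∧ ram(3) of `W`). HONEST
FRAMING: no label changes; nothing here is "finishing BSD".
-/

set_option autoImplicit false

noncomputable section

open scoped Classical MatrixGroups ModularForm

open CongruenceSubgroup WeierstrassCurve Literature.NumberTheory.EllipticCurves
  Literature.NumberTheory.EllipticCurves.ModularForms
  Literature.NumberTheory.GaloisRepresentations

namespace Literature.NumberTheory.EllipticCurves.Wuthrich2014

/-- **Kato's divisibility at a SPLIT MULTIPLICATIVE `p = 3` under surjective `ρ_{E,3^∞}`, read over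
`K = ℚ(ζ₃)` (Wuthrich 2014 Thm. 3 with its attribution sentence, p. 383; Cor. 19 "or `I char_Λ X(E)` in
the split multiplicative case", first case of the proof, p. 399):
`T · char_{Λ(Γ)} X(E/ℚ(ζ_{3^∞})) ∋ u · L₃(E, ω⁰, T) · L₃(E, ω¹, T)`.** As printed (§1,
p. 383): "We formulate it here for the full cyclotomic `ℤ_p^×`-extension. Theorem 3. Let `E` be an
elliptic curve and `p` an odd prime of semi-stable reduction. Assume that `E[p]` is reducible […]. Then
the characteristic series of the dual of the Selmer group over the cyclotomic extension [divides the
ideal generated by `L_p(E)`]. […] This theorem was proven by Kato in the case that [the reduction is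
ordinary and] the representation on the Tate module was surjective."; Cor. 19 (p. 398): "… `char_Λ X(E)`,
or `I char_Λ X(E)` in the split multiplicative case, divides the ideal generated by `L_p(E)`", proof
(p. 399): "in the first case the representation `ρ_p : G_ℚ → Aut(T_p E)` is surjective […]".
`Λ = ℤ_p⟦Gal(ℚ(ζ_{p^∞})/ℚ)⟧`, `I` its augmentation ideal, `X(E)` the dual of `lim_n Sel(E/ℚ(ζ_{p^n}))`
(§5 p. 397; torsion: loc. cit. and Greenberg LNM 1716 Thm. 1.5 for the abelian base `ℚ(ζ₃)`),
`L_p(E) ∈ Λ` (Cor. 18) the Néron-normalised one-term MTT measure at the multiplicative prime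
(`ε(p) = 0`, `α = a_p = +1`). For `p = 3`: `ℚ(ζ_{3^∞}) = K_∞`, `K = ℚ(ζ₃)`, `X(E) = X(E/K_∞)` = the
tree's Iwasawa module of any `K`-model `V'` of `E_K` (`κ` cyclotomic, `χ₃(γ)·ζ = 4`), and
`Λ(G) = Λ(Γ)e₊ ⊕ Λ(Γ)e₋`, `e₊I = (T)`, `e₋I = e₋Λ` give
`T · char_{Λ(Γ)} X(E/K_∞) ∋ L₃(E,ω⁰,T)·L₃(E,ω¹,T)`: even branch = THE `L` with
`IsSplitMultPAdicLFunctionOf f 3 L` (exceptional zero), odd branch = `padicLFunctionMinusBranchMult f 1 1`,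
periods `ϖ·Ω_E = Ω⁺_f`, `ϖ'·|Ω⁻(E)| = Ω⁻_f`, units in `u ∈ ℤ₃ˣ`. Image hypothesis spelled
`∀ n, HasSurjectiveModNGaloisRep (3^n)` (as in `kato_charIdeal_dvd_multiplicative_of_surjective`,
p181258, whose clause (3) is the ℚ_∞ form `ι(T · g) = ϖ · L` of the same statement). Hypotheses: `V`
globally minimal, SPLIT multiplicative at `3`, `ρ̄_{V,3^n}` onto for all `n`, `K`, `V'`, `κ`, `γ`, `ζ`,
`f`, `D`, `ϖ`, `ϖ'`, `L` as displayed. Conclusion: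
`D.IsTorsion ∧ ∃ g ∈ char, ∃ u, ι(X · g) = C(u ϖ ϖ')·(L · L⁻₃(f,1,ω¹,T))`. Named fact; nothing
asserted; proposed flags `Wu14-surj-attribution`, `Wu14-Thm16-p3-branch-split`.
**RETIRED as a separate named fact (cell `b2b-bsdres`, referee ruling R120.2, 2026-08-20, endorsing
lit C175 (ii); deprecate-and-add):** this `p = 3` special case is a KERNEL CONSEQUENCE of the odd-`p`
reading `Wuthrich2014.kato_charIdeal_dvd_splitMultiplicative_cyclotomicPrime_of_surjective`
(`SurjectiveMultiplicativeDivisibilityCyclotomicPrime.lean`) — derivation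
`Wuthrich2014.kato_charIdeal_dvd_splitMultiplicative_cyclotomicThree_of_surjective_of_cyclotomicPrime`
(`SurjectiveMultiplicativeDivisibilityCyclotomicThreeOfPrime.lean`, p238280); the cell's class-level
consumers were re-based on the odd-`p` readings in
`Summits/BirchSwinnertonDyer/Rank1Residual/Additive/SemistableTwistRankZeroThreeClassOfPrime.lean`
(p238590). New consumers take the general fact; existing consumers migrate to the `…OfPrime` form
when next touched; this `def` is kept verbatim only until no module references it, then removed.
[cite: Wuthrich2014, Thm. 3 and §1 (p. 383), Cor. 19 and its proof (pp. 398–399), §5 (p. 397), §3 (p. 390), §3.2 (p. 394), Cor. 18 (p. 398)]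
[cite: GreenbergLNM1716, Thm. 1.5 (PDF p. 61)] [cite: Kato2004Asterisque, Thm. 12.5 (4) with (12.5.2) (p. 222)]
[cite: MazurTateTeitelbaum1986Invent, §I.10, §I.13] -/
def kato_charIdeal_dvd_splitMultiplicative_cyclotomicThree_of_surjective : Prop :=
  ∀ (V : WeierstrassCurve ℚ) [V.IsElliptic] [V.IsGloballyMinimal]
    (K : Type) [Field K] [NumberField K] [IsCyclotomicExtension {3} ℚ K]
    (V' : WeierstrassCurve K) [V'.IsElliptic]
    {κ : ZpExtension K 3} {γ : Field.absoluteGaloisGroup K} {N : ℕ} [NeZero N]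
    {f : CuspForm (Gamma0 N) 2},
    V.HasSplitMultiplicativeReductionAtPrime 3 →
    (∀ n : ℕ, V.HasSurjectiveModNGaloisRep (3 ^ n : ℕ)) →
    (∃ C : VariableChange K, C • V.baseChange K = V') →
    κ.IsCyclotomic → κ.IsTopGenerator γ →
    (∃ ζ : ℤ_[3]ˣ, IsOfFinOrder ζ ∧
      ((GaloisRep.cyclotomicCharacter K 3 γ * ζ : ℤ_[3]ˣ) : ℤ_[3]) =
        (cyclotomicGenerator 3 : ℤ_[3])) →
    IsNewformOf V f →
    ∀ (D : V'.SelmerDualData κ γ) (ϖ ϖ' : ℚ),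
      (ϖ : ℝ) * V.realPeriodRat = plusPeriod f →
      (ϖ' : ℝ) * V.imaginaryPeriodRat = minusPeriod f →
    ∀ (L : PowerSeries ℚ_[3]), IsSplitMultPAdicLFunctionOf f 3 L →
      D.IsTorsion ∧
      ∃ g ∈ D.charIdeal, ∃ u : ℤ_[3]ˣ,
        iwasawaToPowerSeries 3 (PowerSeries.X * g) =
          PowerSeries.C (((u : ℤ_[3]) : ℚ_[3]) * (ϖ : ℚ_[3]) * (ϖ' : ℚ_[3])) *
            (L * padicLFunctionMinusBranchMult f (1 : ℚ_[3]) 1)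

end Literature.NumberTheory.EllipticCurves.Wuthrich2014

end
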